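import Summits.QuantumFields.YangMills.Theorems.UnitScaleTiltHalvingHSiteRowsOfSocketsTGammaA
import Summits.QuantumFields.YangMills.Theorems.UnitScaleTiltHalvingH42TopCrossAssemblyR33
import Summits.QuantumFields.YangMills.Theorems.UnitScaleTiltHalvingHSupURhoWindowsRho3Cb
import Summits.QuantumFields.YangMills.Theorems.UnitScaleTiltHalvingHStokesWindowOfCb
import Summits.QuantumFields.YangMills.Theorems.UnitScaleTiltHalvingH59GammaDischargeFlatRho5Pair
import Summits.QuantumFields.YangMills.Theorems.UnitScaleTiltHalvingHT4TLGammaHoldsMember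
import Summits.QuantumFields.YangMills.Theorems.UnitScaleTiltHalvingSLetTauFlatCubeMember
import Summits.QuantumFields.YangMills.Theorems.UnitScaleTiltHalvingHSupURhoWindowsGamma
import Summits.QuantumFields.YangMills.Theorems.UnitScaleTiltHalvingHSiteHtopOfMember
import Summits.QuantumFields.YangMills.Theorems.UnitScaleTiltHalvingHSupURhoWindowsRho3
import Summits.QuantumFields.YangMills.Theorems.UnitScaleTiltHalvingHSiteH42WindowsOfHw
import HarnessLib

/-!
# Line H (`BirthV10.stub_halvingStep`, stmt-QuantumFields-19200) — **v9 PACK-STEP, socket (S9) (successor LEAD-H ★w5-19200 g7 H-NAMER WORDS 14∕18∕19, split (β1)∕(β2); ★★OWNER g29 v8 OF RECORD):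
# THE STEP PACK `PACK₅(2 ≤ K − n)` WITH EVERY [4]∕Theorem-4∕(1.59) ROW DISCHARGED BY KERNEL — displayed `hSockets₂ := ∀ L, Odd L → 1 < L → ∀ (B₀ B₀'H B₂' BG BR cB9), signs → ∃ Cθ (sx ρ₅), 0 ≤ Cθ ∧
# ∀ M′ ≥ 1, L^(sx+1) ∣ M′ → ⟨H42topCrossT v3.2⟩` ONLY.**  The (β2) SHELL re-letter of ✓p691476 `HalvingHMemberPackStepOfSocketsR5.memberPack_step_of_socketsρ5` ((S2)): per `L`
the [Balaban1985BackgroundPropagators] Thm 3.1 letters AT EVERY TRUNCATION come from px9 g5's ✓`HalvingSLetTauFlatCubeMember.SLetτAllL_holds_member` (LOCATE (L-A); the composer's top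
socket `SLetτ` is its `n′ := K − n` instance, px9 03:22Z), Theorem 4's datum row `hT4TLγ` from ★w7-19200 g7's (β1) ✓`HalvingHT4TLGammaHoldsMember.hT4TLγ9_of_sLetτAll` AT THE SAME
constants (floor-parametric in `B₀ Bbd`, any `cB9 > 0`; body = px3∕px9's ✓`hT4Tγ_of_leafSocketsγ` ∘ the JOIN windows ∘ px10's ✓`H59D_allLevels_flat_member5`), and both (1.59) rows from
px10 g3's ✓`H59_rho5_pair` — the socket (S9) is READ at the theorems' constants (`B₀ := Bbd := max` of the two floors, `cB9 := 1`), `sx ρ₅ := max` of the four letter pairs; NO monotonicity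
lemma anywhere; conclusion `PACK₅` UNCHANGED (= ✓`HalvingHSupURho5OfMemberPacks`' `hPack₂`).  INSIDE otherwise = ✓p691476 VERBATIM: composer ✓`HalvingHSiteRowsOfSocketsTGammaR.siteRows_of_socketsTγR`
(k ≥ 2 v3.2) at `t := 0`; ✓p672161's window bridge (`Cw` keeps `(1 + cB9⁻¹)(1 + B₀'H⁻¹)` at the chosen constants), γ rows via ✓`gammaWindows_of_hw`∕`_cstar_of_hw`, WINDOWS-6 via
✓`h42Windows_step_of_hw`, HTOP via ✓`htopSocket_of_member` (ε₁-route).  THE ONE DISPLAYED ROW: `⟨H42topCrossT v3.2⟩` (Prop. 3 (1.42) on the level-`k` collar bonds `cubeLamBP′ ∖ cubeLamB`,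
DATUM-CLOSED, under the ρ5 member prefix with `Cθ·(ρ′+M′+1) ≤ Cr`; print's mechanism = (1.29)@(k−1), the «mixed-end top (1.42)» (M2′)+(N1), OPEN — v10 removes it).
Cell `ym3-torus` (HUMAN RULING D-0037: YM₃ on T³ is ladder rung R3 — NOT d = 4, NOT infinite volume, NOT a mass gap, NOT the Clay problem), width seat `ym3-torus-px20` gen 4.
`--supports stmt-QuantumFields-19200 --as helper`; THEOREMS ONLY (0 `def`, 0 `sorry`), standard axioms, ONE decl-local `maxHeartbeats 400000` inherited from ✓p685747∕✓p691476;
count-neutral; nothing here claims the displayed socket, `hSupUρ5`, the stub, the crux, the rung or the gap.  A6 (WORD 29 GUARD): `⟨H42topCrossT⟩` at `U = 1, gJ = 1, u₁ = 1, λ′ = 0, u = 1, V′ = 1, A′ = 0`.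
References: T. Bałaban, CMP **99** (1985) 75–102 [Balaban1985RegularSpaces] Prop. 3 pp.82–83, (1.42) p.83, (1.59) p.86, Thm 4 p.88, Prop. 5 p.94, p.98; CMP **99** (1985) 389–434
[Balaban1985BackgroundPropagators] Thm 3.1 p.397, Thm 3.3 p.399; CMP **96** (1984) [Balaban1984PropagatorsII] (2.3) p.224; CMP **102** (1985) [Balaban1985Variational] (150)–(156) pp.301–302.
-/

set_option autoImplicit false
noncomputable section
open scoped BigOperators Matrix.Norms.L2Operator
open NormedSpace open Complex (I)
namespace Summit.QuantumFields.YangMills.Theorems.HalvingHMemberPackStepOfStokesRow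
open Literature.MathematicalPhysics.QuantumFieldTheory.Balaban1983to89
open Literature.MathematicalPhysics.QuantumFieldTheory.Balaban1983to89.T3ContinuumYM3Torus
open Literature.MathematicalPhysics.QuantumFieldTheory.Balaban1983to89.T3PrintedRegularMinimiser (RegPr regFibrePr)
open MatrixLog (mlog)
open B5Eq118OneStroke (iterBlockOf)
open B7Prop1Explicit (e expUnit)
open B7Prop1Explicit renaming Site → LSite
open B7Prop2Explicit (unitaryUnits C0 c2' avgIter)
open B7Prop2SpecialUnitary (specialUnitaryUnits mem_specialUnitaryUnits specialUnitaryUnits_le_unitaryUnits)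
open B7Prop3Flat (c3)
open B7Prop1Local (InBox loK bondHiK)
open B7Eq78Linearization (conjR zdBlocking QprimeIter)
open B7Eq92Concrete (mgauge)
open B8Ineq130 (tlo thi)
open B8Ineq132 (covDerivFwd InAk BondTouches)
open B8Eq119TwistedAxial (Restr129 InAx bgT)
open B8Eq131Cubes (cube gs tLo tHi)
open B8Eq131CubesAdmissible (cubeFam)
open B8CubeMemberZd (cubeLamS cubeLamB)
open B8Eq184Proof (gaugeExp cfgExp)
open B8Eq182Proof (gAd)
open B8Eq188Proof (frakF3)
open B8Eq140Level (SideTouches)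
open B8Eq146AExpansion (iEta)
open B8Eq138LandauZd (IsLandau138W covDivB covLap QT logCfg)
open B7Prop4GeneralLevels (logCovIter linCovIter)
open B8Eq155JBound (Jcur wsup)
open B8ScaledSupNorm (bondNorm msup)
open B8Eq1117Concrete (XSpace)
open B8Prop5ContractionKLevel (Bd2 Mc Kc)
open B8LambdaSpaceKLevel (wt)
open B8SpecialUnitaryTrace (trCLM trCLM_apply)
open B10Eq27TorusAxialLog (transl rel pull pull_apply unitsField toUField suIncl gaugeActT axialT unitsField_mem_unitaryUnits)
open B15Eq112TorusCover (lift cover)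
open Node00 (coverAt)
open Summit.QuantumFields.YangMills.Theorems.Prop8ChartDoubleBar (dbarIterU vframeU)
open HalvingHSiteRowsOfSocketsTGammaA (siteRows_of_socketsTγA) open HalvingH42TopCrossAssemblyR33 (h42topCrossT_of_stokes) open HalvingH59GammaDischargeFlatRho5Pair (H59_rho5_pair) open B8Lemma1NonAbelian (lowPart)
open HalvingHT4TLGammaHoldsMember (hT4TLγ9_of_sLetτAll) open HalvingSLetTauFlatCubeMember (SLetτAllL_holds_member)
open HalvingHSupURhoWindowsGamma (gammaWindows_of_hw gammaWindows_cstar_of_hw)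
open B9SupplySockB9P3ZdGamma (cubeLamBP')
open B9SupplySockB9P3ZdBeta (CrossB)
open HalvingHSiteHtopOfMember (htopSocket_of_member)
open HalvingHSiteH42WindowsOfHw (h42Windows_step_of_hw)
open B7Prop4Flat (C2 c4)
open P1FlatCoreCubeInclusion (corner_of_offset room_of_level_k)
open HalvingHSupURhoWindowsRho3Cb (exists_topCall_constants_of_rhoWindow₃_cb) open HalvingHStokesWindowOfCb (window_of_cb)

set_option maxHeartbeats 400000 in
/-- ★★★ **STEP «v10-pre» SHELL (ym3-torus-px20 g4, LEAD-H g7 WORD 20 (4)) — the (S9) step pack with `⟨H42topCrossT⟩` FED BY the (M2′) assembly; displayed: ONLY the Stokes row (b).**  **PACK-STEP v3.1 (EDITION γ, DATUM-CLOSED RESIDUAL) — THE STEP PACK `PACK₄(2 ≤ K − n)` FROM `hSockets₂γ`.**  See the module docstring: per `L` the constants `B₀`, `Cw :=`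
✓p672161's window factor, `Mₚ := 1`; per ρ4-member with `2 ≤ K − n`: ✓`siteRows_of_socketsTγT` at `t := 0` with its 54 + 6 + 11 γ windows from `hw` and `HTOP` closed by the ε₁-route.
[cite: Balaban1985RegularSpaces, Prop. 3 (1.36)-(1.42) pp.82-83, Thm 4 p.88; Balaban1985BackgroundPropagators, Thm 3.1 p.397, Thm 3.3 p.399; Balaban1985Variational, (150)-(156) pp.301-302] -/
theorem memberPack_step_of_stokesRow
    (hStokesL : ∀ L : ℕ, Odd L → 1 < L → ∀ (B₀ B₀'H B₂' BG BR cB9 : ℝ), 0 < B₀ → 0 < B₀'H → 0 ≤ B₂' → 0 ≤ BG → 0 ≤ BR → 0 < cB9 →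
        -- socket (S9): for EVERY choice of the [4]∕(1.59) constants, the (M2′) window constant `Cθ ≥ 0`, the p.98 letters `sx ρ₅`, ONE `∀ M′` binder, and ONLY the collar residual
        ∃ (Cθ : ℝ) (sx ρ₅ : ℕ), 0 ≤ Cθ ∧ ∀ (M' : ℕ), 1 ≤ M' → L ^ (sx + 1) ∣ M' →
        -- binder (b) «v10-pre» (LEAD-H WORD 20 (4)): the (M2′) assembly's STOKES ROW `hStokes` (✓`HalvingH42TopCrossAssemblyR33.h42topCrossT_of_stokes`) at `θb := d·L·α₁∕8`, ∀-closed over the ρ5 member prefix — the ONE displayed row; its supplier is ✓p696030 `HalvingHStokesRowOfCombDefect.hStokes_of_rows` once ITS four rows are theorems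
        (∀ (F : T3Family), F.L = L → ∀ (n K : ℕ) (hnK : n < K) (ρ S M ρ' : ℕ), ρ' = ρ + M + L + S → 1 ≤ M → 2 ≤ S → ∀ (a₅ Cr ε₀ ε₁ : ℝ), 0 < Cr → 4 < Cr → 12 * ((ρ : ℝ) + (M : ℝ)) * a₅ ≤ Cr →
          Cθ * ((((ρ + M + L + S : ℕ) : ℝ) + (M' : ℝ) + 1)) ≤ Cr → L ^ (sx + 1) ∣ ρ + M + L + S → ρ₅ ≤ ρ → 0 < ε₁ → 0 < ε₀ → ε₀ ≤ a₅ → Cr * ε₁ ≤ ε₀ →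
          (10 : ℝ) ^ 29 * (L : ℝ) ^ 12 * (1 + B₀ + B₀⁻¹) ^ 2 * ((1 + B₀'H) * (1 + B₂') * (1 + BG) * (1 + BR)) ^ 5 * (1 + cB9⁻¹) * ((((ρ + M + L + S : ℕ) : ℝ) + (M' : ℝ) + 1) ^ 3 * ε₀) ≤ 1 →
          2 * ρ + (M' + 1 + 2 * (M + L + S)) ≤ F.L ^ (F.m + n) → ∀ (V : GaugeField (F.P n) 0 (Matrix.specialUnitaryGroup (Fin 2) ℂ)), PlaqSmall ε₁ V → ∀ U ∈ regFibrePr F n K hnK.le ε₀ V,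
          ∀ (x₀ : Site (F.P K) 0) (t : ℤ), 0 ≤ t → t ≤ (M' : ℤ) - 1 → ∀ (a : LSite (F.P K).d), a = (fun μ => ((iterBlockOf (K - n) x₀ μ).val : ℤ) - t) →
          ∀ (α₁ α₄ cstar : ℝ), α₁ = 198 * (((ρ' : ℝ) + M' + 1) * ε₀) + 27 * (((ρ' : ℝ) + M' + 1) * ε₀) / ((L : ℝ) * B₀) → cstar = 5 * (F.P K).d * (F.P K).L * B₀ * (ε₀ + α₁) →
          α₄ = 8 * (300 * (L : ℝ) * ((3 * (M' + ρ') + 1 : ℕ) : ℝ) * (B₀'H + 15 * (L : ℝ) ^ 2 * BG * BR + 3 * BG * BR * B₂')) * (5 * ((3 : ℕ) : ℝ) * L * B₀) * (ε₀ + α₁) →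
          ∀ (s : ℝ), s = (198 + 12 * (((M' : ℝ) - 1) + 4 * ρ')) * ε₀ →
          ∀ (gJ : GaugeTransf (F.P K) 0 (Matrix.specialUnitaryGroup (Fin 2) ℂ)) (u₁ : LSite (F.P K).d → (Matrix (Fin 2) (Fin 2) ℂ)ˣ)
          (W : LSite (F.P K).d → Fin (F.P K).d → (Matrix (Fin 2) (Fin 2) ℂ)ˣ) (A : LSite (F.P K).d → Fin (F.P K).d → Matrix (Fin 2) (Fin 2) ℂ) (c₁ c' : ℝ)
          (κf : (Site (F.P K) 0 → Matrix (Fin 2) (Fin 2) ℂ) → (i : ℕ) → GaugeTransf (F.P K) i (Matrix (Fin 2) (Fin 2) ℂ)ˣ) (lam : LSite (F.P K).d → Matrix (Fin 2) (Fin 2) ℂ),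
          InAk (F.P K).L (K - n) (((F.L : ℝ)⁻¹) ^ (K - n)) ε₀ (fun _ => (Set.univ : Set (LSite (F.P K).d))) (pull (unitsField (toUField (GaugeField.gaugeAct gJ U))) 0) →
          (∀ m', m' ≤ K - n → ∀ Λ : ℕ → Set (LSite (F.P K).d), InAx (F.P K).L m' Λ (1 : LSite (F.P K).d → Fin (F.P K).d → (Matrix (Fin 2) (Fin 2) ℂ)ˣ) (pull (unitsField (toUField (GaugeField.gaugeAct gJ U))) 0)) →
          (∀ m', m' ≤ K - n → ∀ (x : LSite (F.P K).d) (ν : Fin (F.P K).d), tlo (F.P K).L (tLo a ρ') m' ≤ x → x + e ν ≤ thi (F.P K).L (tHi a M' ρ') m' →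
          ‖((avgIter (F.P K).L (pull (unitsField (toUField (GaugeField.gaugeAct gJ U))) 0) (K - n - m') x ν : (Matrix (Fin 2) (Fin 2) ℂ)ˣ) : Matrix (Fin 2) (Fin 2) ℂ) - 1‖ < s) →
          (∀ (x : LSite (F.P K).d) (ν : Fin (F.P K).d), tLo a ρ' ≤ x → x + e ν ≤ tHi a M' ρ' → lowPart ν (x - tLo a ρ') = 0 →
          avgIter (F.P K).L (pull (unitsField (toUField (GaugeField.gaugeAct gJ U))) 0) (K - n) x ν = 1) →
          (∀ z, ((u₁ z : (Matrix (Fin 2) (Fin 2) ℂ)ˣ) : Matrix (Fin 2) (Fin 2) ℂ) ∈ Matrix.specialUnitaryGroup (Fin 2) ℂ) →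
          mgauge (1 : LSite (F.P K).d → Fin (F.P K).d → (Matrix (Fin 2) (Fin 2) ℂ)ˣ) u₁ W = pull (unitsField (toUField (GaugeField.gaugeAct gJ U))) 0 →
          0 ≤ c' → 8 * 3800 * ((((F.P K).d + 2) * (F.P K).L : ℕ) : ℝ) ^ 2 * c' ≤ 1 → Real.exp c₁ - 1 ≤ ((F.L : ℝ)⁻¹) ^ (K - n) * c' →
          (∀ z ∈ cube (F.P K).L a M' ρ' (K - n) (K - n), ∀ ν : Fin (F.P K).d, W z ν = cfgExp (((F.L : ℝ)⁻¹) ^ (K - n)) A z ν ∧ ((F.L : ℝ)⁻¹) ^ (K - n) * ‖A z ν‖ ≤ c₁) →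
          (∀ (m : Site (F.P K) 0 → Matrix (Fin 2) (Fin 2) ℂ) (i : ℕ) (y : Site (F.P K) (i + 1)), κf m (i + 1) y = (vframeU (gaugeActT (κf m i) (dbarIterU i (gaugeActT
          (fun s => (u₁ (lift (F.P K) x₀ + rel x₀ s))⁻¹ * Unitary.toUnits (suIncl (gJ s)) : GaugeTransf (F.P K) 0 (Matrix (Fin 2) (Fin 2) ℂ)ˣ)
          (unitsField (toUField U))))) y)⁻¹ * κf m i (emb y) * vframeU (dbarIterU i (gaugeActT
          (fun s => (u₁ (lift (F.P K) x₀ + rel x₀ s))⁻¹ * Unitary.toUnits (suIncl (gJ s)) : GaugeTransf (F.P K) 0 (Matrix (Fin 2) (Fin 2) ℂ)ˣ) (unitsField (toUField U)))) y) →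
          (∀ (m : Site (F.P K) 0 → Matrix (Fin 2) (Fin 2) ℂ) (x : Site (F.P K) 0), ((κf m 0 x : (Matrix (Fin 2) (Fin 2) ℂ)ˣ) : Matrix (Fin 2) (Fin 2) ℂ) = exp (m x)) →
          (∀ x, IsSelfAdjoint (lam x)) → (∀ x, (lam x).trace = 0) → (∀ yc ∈ cubeLamS (F.P K).L a M' ρ' (K - n) (K - n) (K - n),
          κf (((-I) • lam) ∘ fun s : Site (F.P K) 0 => lift (F.P K) x₀ + rel x₀ s) (K - n) (coverAt (F.P K) (K - n) yc) = axialT (dbarIterU (K - n) (gaugeActT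
          (fun s => (u₁ (lift (F.P K) x₀ + rel x₀ s))⁻¹ * Unitary.toUnits (suIncl (gJ s)) : GaugeTransf (F.P K) 0 (Matrix (Fin 2) (Fin 2) ℂ)ˣ)
          (unitsField (toUField U)))) (iterBlockOf (K - n) x₀) (coverAt (F.P K) (K - n) yc)) →
          (∀ j, j ≤ K - n → ∀ b ∈ {b : LSite (F.P K).d × Fin (F.P K).d | SideTouches ((cubeFam false (F.P K).L a M' ρ' (K - n)) j) b.1 b.2},
          ‖lam b.1‖ ≤ α₄ ∧ wt (F.P K).L (((F.L : ℝ)⁻¹) ^ (K - n)) j * ‖covDerivFwd (((F.L : ℝ)⁻¹) ^ (K - n)) (1 : LSite (F.P K).d → Fin (F.P K).d → (Matrix (Fin 2) (Fin 2) ℂ)ˣ) b.2 lam b.1‖ ≤ α₄) →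
          Restr129 (F.P K).L (K - n) (cubeLamS (F.P K).L a M' ρ' (K - n) (K - n)) (1 : LSite (F.P K).d → Fin (F.P K).d → (Matrix (Fin 2) (Fin 2) ℂ)ˣ) u₁ →
          Restr129 (F.P K).L (K - n) (Function.update (cubeLamS (F.P K).L a M' ρ' (K - n) (K - n)) (K - n) ∅) (1 : LSite (F.P K).d → Fin (F.P K).d → (Matrix (Fin 2) (Fin 2) ℂ)ˣ) (u₁ * gaugeExp lam) →
          ∀ yc ∈ cubeLamS (F.P K).L a M' ρ' (K - n) (K - n) (K - n),
          ‖((axialT (dbarIterU (K - n) (gaugeActT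
          (fun s => (u₁ (lift (F.P K) x₀ + rel x₀ s))⁻¹ * Unitary.toUnits (suIncl (gJ s)) : GaugeTransf (F.P K) 0 (Matrix (Fin 2) (Fin 2) ℂ)ˣ)
          (unitsField (toUField U)))) (iterBlockOf (K - n) x₀) (coverAt (F.P K) (K - n) yc) : (Matrix (Fin 2) (Fin 2) ℂ)ˣ) : Matrix (Fin 2) (Fin 2) ℂ) - 1‖ ≤ (((F.P K).d : ℝ) * (F.P K).L * α₁ / 8))) :
    ∀ L : ℕ, Odd L → 1 < L → ∃ (B₀ : ℝ) (_ : 0 ≤ B₀) (Cw : ℝ) (_ : 0 < Cw) (Cθ : ℝ) (_ : 0 ≤ Cθ) (Mₚ sx ρ₅ : ℕ), ∀ (M' : ℕ), 1 ≤ M' → L ^ (sx + 1) ∣ M' →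
      ∀ (ρ S M : ℕ) (hM : 1 ≤ M), Mₚ ≤ M → 2 ≤ S → ∀ (a Cr : ℝ), 0 < Cr → 4 < Cr → 12 * ((ρ : ℝ) + (M : ℝ)) * a ≤ Cr →
      Cθ * ((((ρ + M + L + S : ℕ) : ℝ) + (M' : ℝ) + 1)) ≤ Cr → L ^ (sx + 1) ∣ ρ + M + L + S → ρ₅ ≤ ρ →
      ∀ (ε₀ ε₁ : ℝ), 0 < ε₁ → 0 < ε₀ → ε₀ ≤ a → Cr * ε₁ ≤ ε₀ →
      Cw * ((((ρ + M + L + S : ℕ) : ℝ) + (M' : ℝ) + 1) ^ 3 * ε₀) ≤ 1 →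
      ∀ (Bsz : ℝ), (2985 * (L : ℝ) * B₀ + 405) * ((((ρ + M + L + S : ℕ) : ℝ) + (M' : ℝ) + 1)) ≤ Bsz →
      ∀ F : T3Family, F.L = L → ∀ (n K : ℕ) (hnK : n < K), 2 ≤ K - n → 2 * ρ + (M' + 1 + 2 * (M + L + S)) ≤ F.L ^ (F.m + n) →
        ∀ V : GaugeField (F.P n) 0 (Matrix.specialUnitaryGroup (Fin 2) ℂ), PlaqSmall ε₁ V →
          ∀ U ∈ regFibrePr F n K hnK.le ε₀ V, ∀ x₀ : Site (F.P K) 0,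
              ∃ (t : ℤ) (_ : 0 ≤ t) (_ : t ≤ (M' : ℤ) - 1)
                (gJ : GaugeTransf (F.P K) 0 (Matrix.specialUnitaryGroup (Fin 2) ℂ))
                (u₁ : LSite (F.P K).d → (Matrix (Fin 2) (Fin 2) ℂ)ˣ)
                (W : LSite (F.P K).d → Fin (F.P K).d → (Matrix (Fin 2) (Fin 2) ℂ)ˣ)
                (A : LSite (F.P K).d → Fin (F.P K).d → Matrix (Fin 2) (Fin 2) ℂ)
                (c₁ c' : ℝ)
                (κf : (Site (F.P K) 0 → Matrix (Fin 2) (Fin 2) ℂ) → (i : ℕ) → GaugeTransf (F.P K) i (Matrix (Fin 2) (Fin 2) ℂ)ˣ)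
                (lam : LSite (F.P K).d → Matrix (Fin 2) (Fin 2) ℂ)
                (α₄ cA : ℝ),
                -- hu₁SU
                (∀ z, ((u₁ z : (Matrix (Fin 2) (Fin 2) ℂ)ˣ) : Matrix (Fin 2) (Fin 2) ℂ) ∈ Matrix.specialUnitaryGroup (Fin 2) ℂ) ∧
                -- hW
                (mgauge (1 : LSite (F.P K).d → Fin (F.P K).d → (Matrix (Fin 2) (Fin 2) ℂ)ˣ) u₁ W = pull (unitsField (toUField (GaugeField.gaugeAct gJ U))) 0) ∧
                -- hchart₀
                (∀ b ∈ {b : LSite (F.P K).d × Fin (F.P K).d | SideTouches (cubeFam false (F.P K).L (fun μ => ((iterBlockOf (K - n) x₀ μ).val : ℤ) - t) M' (ρ + M + L + S) (K - n) 0) b.1 b.2},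
      W b.1 b.2 = cfgExp (((F.L : ℝ)⁻¹) ^ (K - n)) A b.1 b.2) ∧
                -- hc'
                (0 ≤ c') ∧
                -- hbudget
                (8 * 3800 * ((((F.P K).d + 2) * (F.P K).L : ℕ) : ℝ) ^ 2 * c' ≤ 1) ∧
                -- hc₁
                (Real.exp c₁ - 1 ≤ ((F.L : ℝ)⁻¹) ^ (K - n) * c') ∧
                -- hchartTop
                (∀ z ∈ cube (F.P K).L (fun μ => ((iterBlockOf (K - n) x₀ μ).val : ℤ) - t) M' (ρ + M + L + S) (K - n) (K - n), ∀ ν : Fin (F.P K).d,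
      W z ν = cfgExp (((F.L : ℝ)⁻¹) ^ (K - n)) A z ν ∧ ((F.L : ℝ)⁻¹) ^ (K - n) * ‖A z ν‖ ≤ c₁) ∧
                -- hκfs
                (∀ (m : Site (F.P K) 0 → Matrix (Fin 2) (Fin 2) ℂ) (i : ℕ) (y : Site (F.P K) (i + 1)),
      κf m (i + 1) y = (vframeU (gaugeActT (κf m i) (dbarIterU i (gaugeActT
        (fun s => (u₁ (lift (F.P K) x₀ + rel x₀ s))⁻¹ * Unitary.toUnits (suIncl (gJ s)) : GaugeTransf (F.P K) 0 (Matrix (Fin 2) (Fin 2) ℂ)ˣ)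
        (unitsField (toUField U))))) y)⁻¹ * κf m i (emb y) *
        vframeU (dbarIterU i (gaugeActT
          (fun s => (u₁ (lift (F.P K) x₀ + rel x₀ s))⁻¹ * Unitary.toUnits (suIncl (gJ s)) : GaugeTransf (F.P K) 0 (Matrix (Fin 2) (Fin 2) ℂ)ˣ)
          (unitsField (toUField U)))) y) ∧
                -- hκf0
                (∀ (m : Site (F.P K) 0 → Matrix (Fin 2) (Fin 2) ℂ) (x : Site (F.P K) 0), ((κf m 0 x : (Matrix (Fin 2) (Fin 2) ℂ)ˣ) : Matrix (Fin 2) (Fin 2) ℂ) = exp (m x)) ∧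
                -- hα0
                (0 ≤ α₄) ∧
                -- hα
                (α₄ ≤ 1 / 70) ∧
                -- hcA0
                (0 ≤ cA) ∧
                -- hcA
                (cA ≤ 1 / 12) ∧
                -- hsa
                (∀ x, IsSelfAdjoint (lam x)) ∧
                -- htr
                (∀ x, (lam x).trace = 0) ∧
                -- hsupp
                (∀ x, x ∉ cubeFam false (F.P K).L (fun μ => ((iterBlockOf (K - n) x₀ μ).val : ℤ) - t) M' (ρ + M + L + S) (K - n) 0 → lam x = 0) ∧
                -- h108₀
                (∀ b ∈ {b : LSite (F.P K).d × Fin (F.P K).d | SideTouches (cubeFam false (F.P K).L (fun μ => ((iterBlockOf (K - n) x₀ μ).val : ℤ) - t) M' (ρ + M + L + S) (K - n) 0) b.1 b.2},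
      ‖lam b.1‖ ≤ α₄ ∧ wt (F.P K).L (((F.L : ℝ)⁻¹) ^ (K - n)) 0 *
        ‖covDerivFwd (((F.L : ℝ)⁻¹) ^ (K - n)) (1 : LSite (F.P K).d → Fin (F.P K).d → (Matrix (Fin 2) (Fin 2) ℂ)ˣ) b.2 lam b.1‖ ≤ α₄) ∧
                -- hmult
                (∃ μ : ℕ → LSite (F.P K).d → Matrix (Fin 2) (Fin 2) ℂ, ∀ x ∈ cubeFam false (F.P K).L (fun μ => ((iterBlockOf (K - n) x₀ μ).val : ℤ) - t) M' (ρ + M + L + S) (K - n) 0,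
      covLap (((F.L : ℝ)⁻¹) ^ (K - n)) (1 : LSite (F.P K).d → Fin (F.P K).d → (Matrix (Fin 2) (Fin 2) ℂ)ˣ)
        ((cubeFam false (F.P K).L (fun μ => ((iterBlockOf (K - n) x₀ μ).val : ℤ) - t) M' (ρ + M + L + S) (K - n) 0).indicator fun y =>
          covDivB (((F.L : ℝ)⁻¹) ^ (K - n)) (1 : LSite (F.P K).d → Fin (F.P K).d → (Matrix (Fin 2) (Fin 2) ℂ)ˣ) A y +
          covLap (((F.L : ℝ)⁻¹) ^ (K - n)) (1 : LSite (F.P K).d → Fin (F.P K).d → (Matrix (Fin 2) (Fin 2) ℂ)ˣ) lam y +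
          ((conjR (gaugeExp lam y)⁻¹ (covDivB (((F.L : ℝ)⁻¹) ^ (K - n)) (1 : LSite (F.P K).d → Fin (F.P K).d → (Matrix (Fin 2) (Fin 2) ℂ)ˣ) A y) -
              covDivB (((F.L : ℝ)⁻¹) ^ (K - n)) (1 : LSite (F.P K).d → Fin (F.P K).d → (Matrix (Fin 2) (Fin 2) ℂ)ˣ) A y) +
            (gAd (covLap (((F.L : ℝ)⁻¹) ^ (K - n)) (1 : LSite (F.P K).d → Fin (F.P K).d → (Matrix (Fin 2) (Fin 2) ℂ)ˣ) lam y) (lam y) -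
              covLap (((F.L : ℝ)⁻¹) ^ (K - n)) (1 : LSite (F.P K).d → Fin (F.P K).d → (Matrix (Fin 2) (Fin 2) ℂ)ˣ) lam y) +
            ∑ μ, frakF3 (((F.L : ℝ)⁻¹) ^ (K - n)) (1 : LSite (F.P K).d → Fin (F.P K).d → (Matrix (Fin 2) (Fin 2) ℂ)ˣ) lam A y μ)) x =
        QT (F.P K).L (K - n) (cubeLamS (F.P K).L (fun μ => ((iterBlockOf (K - n) x₀ μ).val : ℤ) - t) M' (ρ + M + L + S) (K - n) (K - n)) (1 : LSite (F.P K).d → Fin (F.P K).d → (Matrix (Fin 2) (Fin 2) ℂ)ˣ) μ x) ∧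
                -- htopId
                (∀ yc ∈ cubeLamS (F.P K).L (fun μ => ((iterBlockOf (K - n) x₀ μ).val : ℤ) - t) M' (ρ + M + L + S) (K - n) (K - n) (K - n),
      κf (((-I) • lam) ∘ fun s : Site (F.P K) 0 => lift (F.P K) x₀ + rel x₀ s) (K - n) (coverAt (F.P K) (K - n) yc) =
        axialT (dbarIterU (K - n) (gaugeActT
          (fun s => (u₁ (lift (F.P K) x₀ + rel x₀ s))⁻¹ * Unitary.toUnits (suIncl (gJ s)) : GaugeTransf (F.P K) 0 (Matrix (Fin 2) (Fin 2) ℂ)ˣ)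
          (unitsField (toUField U)))) (iterBlockOf (K - n) x₀) (coverAt (F.P K) (K - n) yc)) ∧
                -- hA0
                (∀ x ∈ cubeFam false (F.P K).L (fun μ => ((iterBlockOf (K - n) x₀ μ).val : ℤ) - t) M' (ρ + M + L + S) (K - n) 0, ∀ μ : Fin (F.P K).d,
      wt (F.P K).L (((F.L : ℝ)⁻¹) ^ (K - n)) 0 * ‖A x μ‖ ≤ cA ∧
        wt (F.P K).L (((F.L : ℝ)⁻¹) ^ (K - n)) 0 *
          ‖conjR ((1 : LSite (F.P K).d → Fin (F.P K).d → (Matrix (Fin 2) (Fin 2) ℂ)ˣ) (x - e μ) μ)⁻¹ (A (x - e μ) μ)‖ ≤ cA) ∧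
                -- hX1
                (∀ j, j ≤ K - n → ∀ z ∈ cube (F.P K).L (fun μ => ((iterBlockOf (K - n) x₀ μ).val : ℤ) - t) M' (ρ + M + L + S) (K - n) j, ∀ ν' : Fin (F.P K).d,
      (F.L : ℝ) ^ j * ((F.L : ℝ)⁻¹) ^ (K - n) *
        ‖logCfg (((F.L : ℝ)⁻¹) ^ (K - n)) (mgauge (1 : LSite (F.P K).d → Fin (F.P K).d → (Matrix (Fin 2) (Fin 2) ℂ)ˣ) (gaugeExp lam)⁻¹
          (cfgExp (((F.L : ℝ)⁻¹) ^ (K - n)) A)) z ν'‖ ≤ Bsz * ε₀) ∧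
                -- hX2
                (∀ j, j ≤ K - n → ∀ z ∈ cube (F.P K).L (fun μ => ((iterBlockOf (K - n) x₀ μ).val : ℤ) - t) M' (ρ + M + L + S) (K - n) j, ∀ ν' μ' : Fin (F.P K).d,
      z + e μ' ∈ cube (F.P K).L (fun μ => ((iterBlockOf (K - n) x₀ μ).val : ℤ) - t) M' (ρ + M + L + S) (K - n) 0 →
      ((F.L : ℝ) ^ j * ((F.L : ℝ)⁻¹) ^ (K - n)) ^ 2 * (F.L : ℝ) ^ (K - n) *
        ‖logCfg (((F.L : ℝ)⁻¹) ^ (K - n)) (mgauge (1 : LSite (F.P K).d → Fin (F.P K).d → (Matrix (Fin 2) (Fin 2) ℂ)ˣ) (gaugeExp lam)⁻¹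
            (cfgExp (((F.L : ℝ)⁻¹) ^ (K - n)) A)) (z + e μ') ν' -
          logCfg (((F.L : ℝ)⁻¹) ^ (K - n)) (mgauge (1 : LSite (F.P K).d → Fin (F.P K).d → (Matrix (Fin 2) (Fin 2) ℂ)ˣ) (gaugeExp lam)⁻¹
            (cfgExp (((F.L : ℝ)⁻¹) ^ (K - n)) A)) z ν'‖ ≤ Bsz * ε₀) := by
  intro L hodd hL
  -- ρ6: BOTH (1.59) rows are THEOREMS on print's p. 98 sub-lattice (px10 g3 ✓`H59_rho5_pair`); read the sockets above their floor `Bs`, collar constant `Bbd := Bs`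
  obtain ⟨Bs, sxp, ρ₅p, hBs1, HT, HD, -⟩ := H59_rho5_pair L hL
  -- v9: the [4] letters at EVERY truncation (px9 g5 ✓`SLetτAllL_holds_member`) and Theorem 4's datum row at THE SAME constants (★w7-19200 g7 (β1) ✓`hT4TLγ9_of_sLetτAll`)
  obtain ⟨B₀'H, B₂', BG, BR, sxS, ρS, hB₀'H, hB₂', hBG, hBR, HS⟩ := SLetτAllL_holds_member L hL
  obtain ⟨Bs4, sx4, ρ4, hBs4, H4⟩ := hT4TLγ9_of_sLetτAll L hL hB₀'H hB₂' hBG hBR HS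
  -- socket letters: `B₀ := Bbd := max Bs Bs4` (both floors), any `cB9 > 0`; the socket (S9) is then READ at these constants
  obtain ⟨B₀, hBsB₀, hBs4B₀⟩ : ∃ B₀ : ℝ, Bs ≤ B₀ ∧ Bs4 ≤ B₀ := ⟨max Bs Bs4, le_max_left _ _, le_max_right _ _⟩
  obtain ⟨cB9, hcB9⟩ : ∃ c : ℝ, 0 < c := ⟨1, one_pos⟩
  have hB₀ : 0 < B₀ := lt_of_lt_of_le (lt_of_lt_of_le zero_lt_one hBs1) hBsB₀
  have hBbd : (0 : ℝ) ≤ B₀ := hB₀.le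
  obtain ⟨Cθ, sxs, ρ₅s, hCθ0, hrows⟩ := hStokesL L hodd hL B₀ B₀'H B₂' BG BR cB9 hB₀ hB₀'H hB₂' hBG hBR hcB9
  refine ⟨B₀, hB₀.le,
    (10 : ℝ) ^ 29 * (L : ℝ) ^ 12 * (1 + B₀ + B₀⁻¹) ^ 2 * ((1 + B₀'H) * (1 + B₂') * (1 + BG) * (1 + BR)) ^ 5 * (1 + cB9⁻¹) * (1 + B₀'H⁻¹), by positivity, Cθ, hCθ0,
    1, max (max (max sxs sxp) sx4) sxS, max (max (max ρ₅s ρ₅p) ρ4) ρS,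
    fun M' hM' hdvM' ρ S M hM hMₚ hS a₅ Cr hCr hCr4 h12 hCθ hdiv hρ₅ ε₀ ε₁ hε₁ hε₀ hε₀a hCrε hwP Bsz hBsz F hF n K hnK h2 hroom V hV U hU x₀ => ?_⟩
  -- the four letter pairs' projections from the pack's `sx ρ₅ := max …`
  have hdvM'4 : L ^ (sx4 + 1) ∣ M' := (Nat.pow_dvd_pow L (by omega)).trans hdvM'
  have hdvM'S : L ^ (sxS + 1) ∣ M' := (Nat.pow_dvd_pow L (by omega)).trans hdvM'
  have hdiv4 : L ^ (sx4 + 1) ∣ ρ + M + L + S := (Nat.pow_dvd_pow L (by omega)).trans hdiv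
  have hdivS : L ^ (sxS + 1) ∣ ρ + M + L + S := (Nat.pow_dvd_pow L (by omega)).trans hdiv
  have hρ4 : ρ4 ≤ ρ := le_trans (le_trans (le_max_right _ _) (le_max_left _ _)) hρ₅
  have hρS : ρS ≤ ρ + M + L + S := le_trans ((le_max_right _ _).trans hρ₅) (by omega)
  have hdvM's : L ^ (sxs + 1) ∣ M' := (Nat.pow_dvd_pow L (by omega)).trans hdvM'
  have hdvM'p : L ^ (sxp + 1) ∣ M' := (Nat.pow_dvd_pow L (by omega)).trans hdvM'
  have hdivs : L ^ (sxs + 1) ∣ ρ + M + L + S := (Nat.pow_dvd_pow L (by omega)).trans hdiv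
  have hdivp : L ^ (sxp + 1) ∣ ρ + M + L + S := (Nat.pow_dvd_pow L (by omega)).trans hdiv
  have hρ₅s : ρ₅s ≤ ρ := (((le_max_left _ _).trans (le_max_left _ _)).trans (le_max_left _ _)).trans hρ₅
  have hρ₅p : ρ₅p ≤ ρ := (((le_max_right _ _).trans (le_max_left _ _)).trans (le_max_left _ _)).trans hρ₅
  have hCross := hrows M' hM' hdvM's
  classical
  -- the pack's smallness carries the (K-final) factor `(1 + cB9⁻¹)` AND WINDOWS-6's `(1 + B₀'H⁻¹)`; each consumer drops the factor it does not need
  have hC9 : (1 : ℝ) ≤ 1 + cB9⁻¹ := by have := (inv_pos.2 hcB9).le; linarith only [this]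
  have hCH : (1 : ℝ) ≤ 1 + B₀'H⁻¹ := by have := (inv_pos.2 hB₀'H).le; linarith only [this]
  have hw : (10 : ℝ) ^ 29 * (L : ℝ) ^ 12 * (1 + B₀ + B₀⁻¹) ^ 2 * ((1 + B₀'H) * (1 + B₂') * (1 + BG) * (1 + BR)) ^ 5 * (1 + cB9⁻¹) *
      (((((ρ + M + L + S : ℕ) : ℝ)) + (M' : ℝ) + 1) ^ 3 * ε₀) ≤ 1 :=
    (mul_le_mul_of_nonneg_right (le_mul_of_one_le_right (by positivity) hCH) (by positivity)).trans hwP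
  have hw42 : (10 : ℝ) ^ 29 * (L : ℝ) ^ 12 * (1 + B₀ + B₀⁻¹) ^ 2 * ((1 + B₀'H) * (1 + B₂') * (1 + BG) * (1 + BR)) ^ 5 * (1 + B₀'H⁻¹) *
      (((((ρ + M + L + S : ℕ) : ℝ)) + (M' : ℝ) + 1) ^ 3 * ε₀) ≤ 1 := by
    refine (mul_le_mul_of_nonneg_right ?_ (by positivity)).trans hwP
    exact mul_le_mul_of_nonneg_right (le_mul_of_one_le_right (by positivity) hC9) (by linarith only [hCH])
  have hL3 : 3 ≤ L := by obtain ⟨r, hr⟩ := hodd; omega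
  have hd3 : (F.P K).d = 3 := T3Family.P_d F K
  have hLF : (F.P K).L = F.L := rfl
  have hM'z : (0 : ℤ) ≤ (M' : ℤ) - 1 := by linarith only [show (1 : ℤ) ≤ (M' : ℤ) from by exact_mod_cast hM']
  have hL2P : 2 ≤ (F.P K).L := by rw [hLF, hF]; omega
  have hLr : ((F.P K).L : ℝ) = (L : ℝ) := by rw [hLF, hF]
  have hLpos : (0 : ℝ) < ((F.P K).L : ℝ) := by rw [hLr]; exact_mod_cast (show 0 < L by omega)
  have hw' := hw
  rw [← hLr] at hw'
  obtain ⟨m₀, α₀, α₁, a₆₆, cstar, B₀', α₄, C₂, cB, cA, cDA, c', σ, δ, ω, Cb, Cl, τ₀, e0, eα₀, ea, e1, ec, eB, e4, eC, ecB, ecA, ecDA, ecp, eσ, hδ, hω, hτ₀,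
    ⟨-, -, hα₁, -, hsα₁, ha66lo, hB₀', -, hα₄, -, hcs0x, hCb0x, -, -, hcA0, -, -, -, -⟩,
    ⟨-, hs₂, ha4, h2s, hα3, hα4, h16, hd5, -, -, hside, h50, -, -⟩,
    ⟨-, -, hside₀, -, hsmall₁, hcBlo, hcAlo, hcDAlo, hsmall, hc₃, hsc, hα₃', hs₁, hs₂', hs₃, hs₄, hs₅, hs₆, hs₇, hprod8, hcA13, hCblo, hCb₀, hCllo, hCl₀, hCbρ, hClB⟩,
    ⟨hα70, hcA12, -, -, -, -, hs6, -, hσ, hLa2, -, hbudgetσ, hm, hr⟩, hwin, hCbs⟩ :=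
    exists_topCall_constants_of_rhoWindow₃_cb (F.P K).d (F.P K).L hd3 hL2P hB₀ hB₀'H hB₂' hBG hBR hcB9 M' (ρ + M + L + S) hε₀ hw'
  subst α₀
  have hM'r : (1 : ℝ) ≤ (M' : ℝ) := by exact_mod_cast hM'
  have hρ'0 : (0 : ℝ) ≤ ((ρ + M + L + S : ℕ) : ℝ) := Nat.cast_nonneg _
  have hX1 : (1 : ℝ) ≤ ((((ρ + M + L + S : ℕ) : ℝ)) + (M' : ℝ) + 1) := by linarith only [hρ'0, hM'r]
  have hsdef : a₆₆ = (198 + 12 * (((M' : ℝ) - 1) + 4 * (ρ + M + L + S : ℕ))) * ε₀ := by rw [ea]; ring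
  have hε : 10 ^ 7 * (F.L : ℝ) ^ 3 * ε₀ ≤ 1 := by
    rw [hF]
    have hL1 : (1 : ℝ) ≤ (L : ℝ) := by exact_mod_cast (show 1 ≤ L by omega)
    have hA : (1 : ℝ) ≤ (1 + B₀ + B₀⁻¹) ^ 2 :=
      one_le_pow₀ (by have := (inv_pos.2 hB₀).le; linarith only [this, hB₀.le])
    have hB : (1 : ℝ) ≤ ((1 + B₀'H) * (1 + B₂') * (1 + BG) * (1 + BR)) ^ 5 := by
      refine one_le_pow₀ ?_
      have a1 : (1 : ℝ) ≤ 1 + B₀'H := by linarith only [hB₀'H.le]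
      have a2 : (1 : ℝ) ≤ 1 + B₂' := by linarith only [hB₂']
      have a3 : (1 : ℝ) ≤ 1 + BG := by linarith only [hBG]
      have a4 : (1 : ℝ) ≤ 1 + BR := by linarith only [hBR]
      exact one_le_mul_of_one_le_of_one_le (one_le_mul_of_one_le_of_one_le (one_le_mul_of_one_le_of_one_le a1 a2) a3) a4
    have hC : (1 : ℝ) ≤ 1 + cB9⁻¹ := by have := (inv_pos.2 hcB9).le; linarith only [this]
    have hX3 : (1 : ℝ) ≤ ((((ρ + M + L + S : ℕ) : ℝ)) + (M' : ℝ) + 1) ^ 3 := one_le_pow₀ hX1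
    have h10 : (10 : ℝ) ^ 7 ≤ 10 ^ 29 := by norm_num
    have hL312 : (L : ℝ) ^ 3 ≤ (L : ℝ) ^ 12 := pow_le_pow_right₀ hL1 (by norm_num)
    calc 10 ^ 7 * (L : ℝ) ^ 3 * ε₀ = 10 ^ 7 * (L : ℝ) ^ 3 * 1 * 1 * 1 * (1 * ε₀) := by ring
      _ ≤ 10 ^ 29 * (L : ℝ) ^ 12 * (1 + B₀ + B₀⁻¹) ^ 2 * ((1 + B₀'H) * (1 + B₂') * (1 + BG) * (1 + BR)) ^ 5 * (1 + cB9⁻¹) *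
          (((((ρ + M + L + S : ℕ) : ℝ)) + (M' : ℝ) + 1) ^ 3 * ε₀) := by gcongr
      _ ≤ 1 := hw
  have hL0 : (L : ℝ) ≠ 0 := by exact_mod_cast (show L ≠ 0 by omega)
  have hB0 : B₀ ≠ 0 := hB₀.ne'
  have ecs : cstar = 15 * (L : ℝ) * B₀ * ε₀ + 2970 * (L : ℝ) * B₀ * (((((ρ + M + L + S : ℕ) : ℝ)) + (M' : ℝ) + 1) * ε₀) + 405 * (((((ρ + M + L + S : ℕ) : ℝ)) + (M' : ℝ) + 1) * ε₀) := by
    rw [ec, e1, hd3, hLr]; push_cast; field_simp; ring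
  have hcsB : cstar ≤ Bsz * ε₀ := by
    have h1 : 15 * (L : ℝ) * B₀ * ε₀ ≤ 15 * (L : ℝ) * B₀ * (((((ρ + M + L + S : ℕ) : ℝ)) + (M' : ℝ) + 1) * ε₀) :=
      mul_le_mul_of_nonneg_left (le_mul_of_one_le_left hε₀.le hX1) (by positivity)
    have h2 : (2985 * (L : ℝ) * B₀ + 405) * ((((ρ + M + L + S : ℕ) : ℝ)) + (M' : ℝ) + 1) * ε₀ ≤ Bsz * ε₀ := mul_le_mul_of_nonneg_right hBsz hε₀.le
    calc cstar = 15 * (L : ℝ) * B₀ * ε₀ + 2970 * (L : ℝ) * B₀ * (((((ρ + M + L + S : ℕ) : ℝ)) + (M' : ℝ) + 1) * ε₀) + 405 * (((((ρ + M + L + S : ℕ) : ℝ)) + (M' : ℝ) + 1) * ε₀) := ecs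
      _ ≤ 15 * (L : ℝ) * B₀ * (((((ρ + M + L + S : ℕ) : ℝ)) + (M' : ℝ) + 1) * ε₀) + 2970 * (L : ℝ) * B₀ * (((((ρ + M + L + S : ℕ) : ℝ)) + (M' : ℝ) + 1) * ε₀) + 405 * (((((ρ + M + L + S : ℕ) : ℝ)) + (M' : ℝ) + 1) * ε₀) := by linarith only [h1]
      _ = (2985 * (L : ℝ) * B₀ + 405) * ((((ρ + M + L + S : ℕ) : ℝ)) + (M' : ℝ) + 1) * ε₀ := by ring
      _ ≤ Bsz * ε₀ := h2
  have hα₁def : α₁ = 198 * (((((ρ + M + L + S : ℕ) : ℝ)) + (M' : ℝ) + 1) * ε₀) + 27 * (((((ρ + M + L + S : ℕ) : ℝ)) + (M' : ℝ) + 1) * ε₀) / ((L : ℝ) * B₀) := by rw [e1, hLr]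
  have hcdef : cstar = 5 * (F.P K).d * (F.P K).L * B₀ * (ε₀ + α₁) := ec
  have hα₄def : α₄ = 8 * (300 * (L : ℝ) * ((3 * (M' + (ρ + M + L + S)) + 1 : ℕ) : ℝ) * (B₀'H + 15 * (L : ℝ) ^ 2 * BG * BR + 3 * BG * BR * B₂')) *
      (5 * ((3 : ℕ) : ℝ) * L * B₀) * (ε₀ + α₁) := by rw [e4, eB, e0, hd3, hLr]
  have hm₀ : (F.P K).d * (M' + (ρ + M + L + S)) ≤ m₀ := by rw [e0, hd3]; omega
  have hcB2 : cstar = 5 * ((F.P K).d : ℝ) * (F.P K).L * B₀ * (ε₀ + α₁) := ec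
  have hα₄B2 : α₄ = 8 * B₀' * (5 * ((F.P K).d : ℝ) * (F.P K).L * B₀) * (ε₀ + α₁) := e4
  -- EDITION γ: [3] Prop. 4's windows one level lower + the γ-shaped `C₂` row and both (1.61) rows (✓`HalvingHSupURhoWindowsGamma`, HARVEST-v2γ, same `Cw`, `Z := 1 + cB9⁻¹`)
  obtain ⟨hα3γ, hα4γ, h16Pγ, hsmallPγ, hc₃Pγ, hC₂γ, h61γ, h61γ₀⟩ :=
    gammaWindows_of_hw (F.P K).d (F.P K).L hd3 hL2P M' (ρ + M + L + S) hε₀ hB₀ hB₀'H hB₂' hBG hBR hC9 e0 e1 hcB2 eB hα₄B2 hw'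
  obtain ⟨h16γ, hsmallγ, hc₃γ⟩ := gammaWindows_cstar_of_hw (F.P K).d (F.P K).L hd3 hL2P M' (ρ + M + L + S) hε₀ hB₀ hB₀'H hB₂' hBG hBR hC9 e0 e1 hcB2 eB hα₄B2 hw'
  -- the collar constant's window in the composer's letters
  have hBd9 : 4 * B₀ ≤ (3 * (L : ℝ) - 1) * B₀ := by
    have hL3r : (3 : ℝ) ≤ (L : ℝ) := by exact_mod_cast hL3
    exact mul_le_mul_of_nonneg_right (by linarith only [hL3r]) hB₀.le
  have hBd' : 4 * B₀ ≤ (((F.P K).d : ℝ) * (F.P K).L - 1) * B₀ := by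
    have h3L : (((F.P K).d : ℝ)) * ((F.P K).L : ℝ) = 3 * (L : ℝ) := by rw [hd3, hLr]; norm_num
    rw [h3L]; exact hBd9
  -- member geometry (corner at `t := 0`), WINDOWS-6 at the t-shape of record `2·(X·ε₁)` (reassociated), HTOP-CLOSE (ε₁-route), then the composer
  have ha := corner_of_offset x₀ (K - n) (M' := M') le_rfl hM'z
  obtain ⟨hroomW, -, -⟩ := HalvingHSiteDatumOfSockets.member_windows F L hF hnK ρ S M M' (ε₀ := ε₀) hroom x₀ le_rfl hM'z
  have hw42' := hw42
  rw [← hLr] at hw42'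
  obtain ⟨hkb, hbudget42, hr42, hr2, hwin42₀, hε₁l₀⟩ :=
    h42Windows_step_of_hw (F.P K).d (F.P K).L hd3 hL2P h2 M' (ρ + M + L + S) hε₀ hB₀ hB₀'H hB₂' hBG hBR e0 e1 hcB2 eB hα₄B2 hCr4 hε₁.le hCrε hw42'
  have hε₁l : 2 * ((((F.P K).d * (M' + (ρ + M + L + S)) : ℕ) : ℝ) * ε₁) ≤ 1 := by simpa only [mul_assoc] using hε₁l₀
  have hwin42 : 2 * ((((F.P K).d * (M' + (ρ + M + L + S)) : ℕ) : ℝ) * ε₁) +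
      (C2 (F.P K).d + 64 * 60800 * ((((F.P K).d + 2) * (F.P K).L : ℕ) : ℝ) ^ 2) * (2 * ((F.P K).L * cstar) + 8 * α₄) ^ 2 <
      2 * ((F.P K).d : ℝ) * (F.P K).L * α₁ := by
    have h := hwin42₀; simp only [mul_assoc] at h ⊢; exact h
  have HTOP' := htopSocket_of_member F hnK x₀ (by omega : 1 ≤ ρ + M + L + S) ha hroomW hε₀ hε hε₁.le V hV U hU hε₁l
  -- (M2′) WINDOWS for ✓`h42topCrossT_of_stokes` at `θb := d·L·α₁∕8`, from the exported second-order row `Cb ≤ 2(ρ′+M′+1)ε₀` (✓`…Rho3Cb`) via ✓`window_of_cb`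
  have hρL' : (F.P K).L ≤ ρ + M + L + S := by rw [hLF, hF]; omega
  have hTpos : (0 : ℝ) < ((F.P K).d : ℝ) * (F.P K).L * α₁ := mul_pos (mul_pos (by rw [hd3]; norm_num) hLpos) hα₁
  have hT : 1782 * ((((ρ + M + L + S : ℕ) : ℝ) + (M' : ℝ) + 1) * ε₀) ≤ ((F.P K).d : ℝ) * (F.P K).L * α₁ := by
    have hL3r : (3 : ℝ) ≤ ((F.P K).L : ℝ) := by rw [hLr]; exact_mod_cast hL3
    have hα₁lo : 198 * ((((ρ + M + L + S : ℕ) : ℝ) + (M' : ℝ) + 1) * ε₀) ≤ α₁ := by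
      rw [hα₁def]; have : 0 ≤ 27 * ((((ρ + M + L + S : ℕ) : ℝ) + (M' : ℝ) + 1) * ε₀) / ((L : ℝ) * B₀) := by positivity
      linarith only [this]
    have hm := mul_le_mul hL3r hα₁lo (by positivity) (by positivity)
    rw [hd3, Nat.cast_ofNat]; linarith only [hm]
  have ha198 : a₆₆ ≤ 198 * ((((ρ + M + L + S : ℕ) : ℝ) + (M' : ℝ) + 1) * ε₀) := by
    rw [hsdef]
    have : 0 ≤ ε₀ * (150 * (((ρ + M + L + S : ℕ) : ℝ)) + 186 * (M' : ℝ) + 12) := by positivity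
    linarith only [this]
  have hs0 : 0 ≤ a₆₆ := by
    rw [hsdef]
    have : 0 ≤ ε₀ * (186 + 12 * (M' : ℝ) + 48 * (((ρ + M + L + S : ℕ) : ℝ))) := by positivity
    linarith only [this]
  have hCb10 : 10 * Cb ≤ 1 := by linarith only [hCbs, hT, hsmall₁]
  obtain ⟨hhalfS, hwin0⟩ := window_of_cb hTpos hT hsmall₁ ha198 hCb0x hCbs
  have hwinS := hwin0.trans_eq (by ring : 2 * (((F.P K).d : ℝ) * (F.P K).L * α₁) = 2 * (F.P K).d * (F.P K).L * α₁)
  exact siteRows_of_socketsTγA F L hF hnK h2 ρ S M M' rfl hε₀ hε hsdef hs6 hroom V U hU x₀ le_rfl hM'z rfl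
    hα₁ hB₀ hB₀' hB₀'H hB₂' hBG hBR hsα₁ hcB2 hα₄B2 hs₂ hside₀ hC₂γ h61γ₀ hsmall₁ hα3 hα4 hα3γ hα4γ h16γ hsmallγ hc₃γ hsmallPγ hc₃Pγ h16Pγ h16 hd5 hside h50 h61γ hcBlo hcAlo hcDAlo hsmall
    hc₃ hsc hα₃' hs₁ hs₂' hs₃ hs₄ hs₅ hs₆ hs₇ hprod8 hα70 hcA0 hcA12 hcA13 hCblo hCllo hCbρ hClB hCb10 hσ hδ hω hτ₀ hbudgetσ hm hm₀ hr hCb₀ hCl₀ hwin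
    hcsB     hkb hbudget42 hr42 hr2 hwin42 HTOP'
    (h42topCrossT_of_stokes (F := F) hnK h2 x₀ hM' hρL' ha hroomW U hε₀ hs0 hCb0x (by positivity) hcs0x hα₄.le hhalfS hwinS hα3γ hα4γ hsmallPγ hc₃Pγ
      (hCross F hF n K hnK ρ S M _ rfl hM hS a₅ Cr ε₀ ε₁ hCr hCr4 h12 hCθ hdivs hρ₅s hε₁ hε₀ hε₀a hCrε hw hroom V hV U hU x₀ 0 le_rfl hM'z _ rfl α₁ α₄ cstar hα₁def hcdef hα₄def a₆₆ hsdef))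
    (H4 M' B₀ B₀ cB9 hBs4B₀ hBs4B₀ hBd9 hcB9 F hF n K hnK ρ S M _ rfl hdiv4 hdvM'4 hρ4 hM hS a₅ Cr ε₀ ε₁ hCr hCr4 h12 hε₁ hε₀ hε₀a hCrε hw
      hroom V hV U hU x₀ 0 le_rfl hM'z _ rfl α₁ α₄ cstar hα₁def hcdef hα₄def a₆₆ hsdef)
    hBbd hBd' (HD M' B₀ B₀'H B₂' BG BR cB9 B₀ hBsB₀ hBsB₀ hB₀'H hB₂' hBG hBR hcB9 F hF n K hnK ρ S M _ rfl h2 hdivp hdvM'p hρ₅p hM hS a₅ Cr ε₀ ε₁ hCr hCr4 h12 hε₁ hε₀ hε₀a hCrε hw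
      hroom V hV U hU x₀ 0 le_rfl hM'z _ rfl α₁ α₄ cstar hα₁def hcdef hα₄def a₆₆ hsdef) (HS F hF n K hnK _ M' (ρ + M + L + S) hdvM'S hdivS hρS (K - n) (by omega) le_rfl)
    (HT M' B₀ B₀'H B₂' BG BR cB9 B₀ hBsB₀ hBsB₀ hB₀'H hB₂' hBG hBR hcB9 F hF n K hnK ρ S M _ rfl hdivp hdvM'p hρ₅p hM hS a₅ Cr ε₀ ε₁ hCr hCr4 h12 hε₁ hε₀ hε₀a hCrε hw
      hroom V hV U hU x₀ 0 le_rfl hM'z _ rfl α₁ α₄ cstar hα₁def hcdef hα₄def a₆₆ hsdef)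

end Summit.QuantumFields.YangMills.Theorems.HalvingHMemberPackStepOfStokesRow

end
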